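import Literature.Computation.Certificates.ConicCertificateLayoutPrimal
import Literature.Computation.Certificates.PosSemidefDecide

/-!
# `certsdp-primal/1` with BOTH admitted witness modes (`chol-residual` and `exact`): kernel-replayable layout

Topic `Literature/Computation/Certificates`; sibling of `ConicCertificateLayout` (the program
`certsdp-problem/1` and the lower kind `certsdp-conic/1`) and of `ConicCertificateLayoutPrimal` (the upper
kind `certsdp-primal/1`, whose `PrimalCert` carries one CHOLESKY-RESIDUAL witness per block).  The released
upper kind admits a SECOND per-block mode (certsdp `docs/FORMAT-primal1.md` §1.1 S2; reader B
`verify_b/SCHEMAS.md` §certsdp-primal/1, quoted):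

> WITNESS `exact` (FORMAT §1.1 S2): no witness keys (`{block, mode}` only) — reader B decides `M_k(y) ⪰ 0`
> by its OWN arithmetic: `L :=` lcm of the denominators of `M_k(y)`, `A := L·M_k(y) ∈ ℤ^{dim×dim}`,
> fraction-free Bareiss elimination WITHOUT pivoting: a negative pivot refutes; a zero pivot demands that
> the whole remaining column below it vanish (else refute) and is skipped; rank = number of positive
> pivots.  […]  It is the mode for blocks on a face of the PSD cone (structural zero rows, rank-deficient
> moment blocks), where no `σ > 0` residual witness can exist.

This file types that mode and the certificate kind over both modes, again in EXACT RATIONAL DATA and with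
BOOLEAN (kernel-evaluable) acceptance checks:

* `exactAccepts M : Bool` — the kernel's own exact decision `decide (PSD.LDLCert M)`: the tree's exact
  `LDLᵀ` without pivoting WITH the zero-pivot rule (`PSD.ldlRows`: "a nonpositive pivot is recorded as `0`
  with factor row `eₖ` and its row/column is dropped"), its output re-checked by the trusted Gram predicate
  `PSD.IsGramCert` (`A = Bᵀ·diag d·B`, `d ≥ 0`) [BlekhermanParriloThomas2012, App. A.1.2]; soundness
  `posSemidef_of_exactAccepts`: `M ⪰ 0` over `ℝ`.  (The readers run the same elimination fraction-free on
  `L·M` — Bareiss's integer form, `BareissFractionFreePsd` / `PsdZeroPivotRule` in this directory; the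
  predicate decided is the same one, `M ⪰ 0`.)
* `PsdWitness n` — the `psd[k]` item of a `certsdp-primal/1` certificate for a block of dimension `n`:
  `chol w` (mode `chol-residual`, `w : CholWitness (Fin n)`) or `exact` (mode `exact`, no data);
  `PsdWitness.accepts` / `PsdWitness.posSemidef`.
* `UpperCert` — `certsdp-primal/1` with one `PsdWitness` per block: `UpperCert.check : Bool` = K-11 of the
  reader spec («`y*_u = 1`, every a-priori bound, every equality row exactly, every inequality row, every
  block's witness accepted for `M_k(y*)`, `c·y* + c₀ ≤ claimed`»), the non-gating `UpperCert.traceCheck`,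
  and soundness `feasible` / `obj_le` / `csInf_le` — Jansson–Chaykin–Keil Theorem 4.1, a primal feasible
  point bounds the optimal value from above [JanssonChaykinKeil2008, Thm 4.1]; `UpperCert.ofPrimalCert`:
  a chol-only `PrimalCert` IS an `UpperCert` with the same verdicts (definitionally; two `example`s).
* the bracket against an accepted lower certificate `LowerCert` (`certsdp-conic/1`) of the same program:
  `UpperCert.lowerBound_le_upperBound(′)`, `UpperCert.csInf_mem_Icc(′)`.

Blocks are indexed by `Fin (dims k)` (dependent sizes), because the kernel `LDLᵀ` of `PosSemidefDecide` is
typed on `Fin n`-indexed matrices.  WHAT IS NOT TYPED: the readers' report-only `rank` (number of positive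
pivots), and COMPLETENESS of the kernel elimination (for symmetric input exactly one of `PSD.LDLCert` /
`PSD.NegCert` holds — stated, deliberately unproved, in `PosSemidefDecide`; soundness does not use it: a
rejected `exact` item proves nothing, an accepted one proves `M ⪰ 0`).
No named facts, no instances, no `sorry`; everything stated is proved.
-/

namespace Literature.Computation.Certificates

open Matrix Finset
open scoped BigOperators

namespace ConicLayout

/-! ### §1 The exact mode of one block: the kernel decides `M ⪰ 0` itself -/

/-- **Exact-mode acceptance** of a rational block (`psd[k] = {block, mode: "exact"}`): the exact `LDLᵀ`
without pivoting, with the zero-pivot rule, computed and re-checked in the kernel — `decide (PSD.LDLCert M)`;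
a `Bool` of the exact data. [cite: BlekhermanParriloThomas2012, App. A.1.2] -/
def exactAccepts {n : ℕ} (M : Matrix (Fin n) (Fin n) ℚ) : Bool :=
  decide (PSD.LDLCert M)

/-- **An accepted exact item proves `M ⪰ 0`** (over `ℝ`): the kernel's Gram certificate
`M = Bᵀ·diag d·B`, `d ≥ 0`. [cite: BlekhermanParriloThomas2012, App. A.1.2] -/
theorem posSemidef_of_exactAccepts {n : ℕ} {M : Matrix (Fin n) (Fin n) ℚ} (h : exactAccepts M = true) :
    (M.map (Rat.cast : ℚ → ℝ)).PosSemidef :=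
  PSD.LDLCert.posSemidef (R := ℝ) (of_decide_eq_true h)

/-- An accepted exact item proves `M ⪰ 0` over `ℚ` itself. [cite: BlekhermanParriloThomas2012, App. A.1.2] -/
theorem posSemidef_rat_of_exactAccepts {n : ℕ} {M : Matrix (Fin n) (Fin n) ℚ}
    (h : exactAccepts M = true) : M.PosSemidef :=
  PSD.LDLCert.posSemidef_rat (of_decide_eq_true h)

/-- An accepted exact item is symmetric (the Gram identity forces it; the readers assemble `M_k(y)` from
data read symmetric). [cite: BlekhermanParriloThomas2012, App. A.1.2] -/
theorem isSymm_of_exactAccepts {n : ℕ} {M : Matrix (Fin n) (Fin n) ℚ} (h : exactAccepts M = true) :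
    M.IsSymm :=
  PSD.LDLCert.isSymm (of_decide_eq_true h)

/-- The `psd[k]` item of a `certsdp-primal/1` certificate for a block of dimension `n`, in either admitted
mode: `chol w` = `{mode: "chol-residual", denom, s, sigma_scaled, R_scaled_lower}` (Rump's residual witness
[cite: Rump1999VerifiedLargeSystems, §4, Algorithm 4.1]), or `exact` = `{mode: "exact"}` (no witness keys;
the verifier decides `M ⪰ 0` by exact elimination [cite: BlekhermanParriloThomas2012, App. A.1.2]). -/
inductive PsdWitness (n : ℕ) where
  /-- mode `chol-residual` with its dyadic Cholesky-residual witness -/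
  | chol (w : CholWitness (Fin n))
  /-- mode `exact` (the kernel's own `LDLᵀ` decision) -/
  | exact

namespace PsdWitness

/-- **Acceptance of a `psd[k]` item** for the rational block `M`: the mode's own test
(`CholWitness.accepts`, resp. `exactAccepts`); a `Bool` of the exact data. [folklore] -/
def accepts {n : ℕ} : PsdWitness n → Matrix (Fin n) (Fin n) ℚ → Bool
  | chol w, M => w.accepts M
  | exact, M => exactAccepts M

/-- **An accepted item proves `M ⪰ 0`** (over `ℝ`), in either mode.
[cite: Rump1999VerifiedLargeSystems, §4 eq. after (12) and Algorithm 4.1 step 7]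
[cite: BlekhermanParriloThomas2012, App. A.1.2] -/
theorem posSemidef {n : ℕ} {w : PsdWitness n} {M : Matrix (Fin n) (Fin n) ℚ} (h : w.accepts M = true) :
    (M.map (Rat.cast : ℚ → ℝ)).PosSemidef := by
  cases w with
  | chol w => exact CholWitness.posSemidef h
  | exact => exact posSemidef_of_exactAccepts h

end PsdWitness

/-! ### §2 `certsdp-primal/1` over both modes: the UPPER bound from an exactly feasible point -/

section Upper

variable {V E I K : Type*} [Fintype V] [Fintype E] [Fintype I] [Fintype K] {dims : K → ℕ}

/-- An upper-bound certificate (`certsdp-primal/1`, both witness modes): an exactly feasible rational point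
`y*` (member `y`), one `psd[k]` item per block (`psd`, mode `chol-residual` or `exact`), and the claimed
bound (`claimed.upper_bound`) — the feasible point `X̂` of [cite: JanssonChaykinKeil2008, Thm 4.1
(exact-data case: the enclosure is the point)] in inequality form; blocks indexed by `Fin (dims k)`. -/
structure UpperCert (V E I K : Type*) (dims : K → ℕ) where
  /-- the rational point `y*` -/
  y : V → ℚ
  /-- one PSD item per block -/
  wit : ∀ k, PsdWitness (dims k)
  /-- `claimed.upper_bound` -/
  upperBound : ℚ

namespace UpperCert

/-- **Acceptance of an upper certificate** (what the readers decide, exactly; K-11 of the reader spec):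
`y*_u = 1`, every a-priori bound, every equality row (exactly), every inequality row, every block's item
accepted for `M_k(y*)` in its own mode, and `c·y* + c₀ ≤ claimed`; a `Bool` of the exact data. [folklore] -/
def check (P : Problem V E I K fun k => Fin (dims k)) (C : UpperCert V E I K dims) : Bool :=
  decide (C.y P.unit = 1) && decide (∀ v, ∀ q ∈ P.rho v, |C.y v| ≤ q) &&
    decide (∀ e, ∑ v, P.rowE e v * C.y v = P.rhs e) &&
    decide (∀ i, ∑ v, P.rowI i v * C.y v ≤ P.upper i) &&
    decide (∀ k, (C.wit k).accepts (P.blockQ k C.y) = true) &&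
    decide (∑ v, P.c v * C.y v + P.c0 ≤ C.upperBound)

/-- The declared a-priori TRACE BOUNDS hold at `y*` (exactly) — reported, non-gating in the readers;
needed only to bracket against a lower certificate with penalised blocks. [folklore] -/
def traceCheck (P : Problem V E I K fun k => Fin (dims k)) (C : UpperCert V E I K dims) : Bool :=
  decide (∀ k, ∀ q ∈ P.tau k, (P.blockQ k C.y).trace ≤ q)

/-- A chol-only certificate (`PrimalCert`, every item in mode `chol-residual`) as an `UpperCert`.
[folklore] -/
def ofPrimalCert (C : PrimalCert V E I K fun k => Fin (dims k)) : UpperCert V E I K dims :=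
  ⟨C.y, fun k => .chol (C.wit k), C.upperBound⟩

/- The embedding preserves both verdicts DEFINITIONALLY (kernel-checked here; restate by `rfl` where
needed): a chol-only `PrimalCert` is accepted as an `UpperCert` iff `PrimalCert.check` accepts it. -/
example (P : Problem V E I K fun k => Fin (dims k)) (C : PrimalCert V E I K fun k => Fin (dims k)) :
    check P (ofPrimalCert C) = PrimalCert.check P C := rfl

example (P : Problem V E I K fun k => Fin (dims k)) (C : PrimalCert V E I K fun k => Fin (dims k)) :
    traceCheck P (ofPrimalCert C) = PrimalCert.traceCheck P C := rfl

omit [Fintype E] [Fintype I] [Fintype K] in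
/-- The real block at a rational point is the cast of the exact block. [folklore] -/
private theorem block_map_ratCast (P : Problem V E I K fun k => Fin (dims k)) (k : K) (y : V → ℚ) :
    P.block k (fun v => (y v : ℝ)) = (P.blockQ k y).map (Rat.cast : ℚ → ℝ) := by
  ext a b
  simp [Problem.block, Problem.blockQ, Matrix.sum_apply, Rat.cast_sum, Rat.cast_mul, Rat.cast_add]

/-- **An accepted upper certificate's point is feasible** (real semantics), whatever the modes of its
items. [cite: JanssonChaykinKeil2008, Thm 4.1] [cite: Rump1999VerifiedLargeSystems, §4, Algorithm 4.1
step 7] [cite: BlekhermanParriloThomas2012, App. A.1.2] -/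
theorem feasible {P : Problem V E I K fun k => Fin (dims k)} {C : UpperCert V E I K dims}
    (h : check P C = true) : P.Feasible fun v => (C.y v : ℝ) := by
  simp only [check, Bool.and_eq_true, decide_eq_true_eq] at h
  obtain ⟨⟨⟨⟨⟨hu, hbox⟩, heq⟩, hle⟩, hpsd⟩, _⟩ := h
  refine ⟨by exact_mod_cast hu, fun v q hq => ?_, fun e => ?_, fun i => ?_, fun k => ?_⟩
  · have := hbox v q hq
    rw [← Rat.cast_abs]; exact_mod_cast this
  · have := heq e
    exact_mod_cast this
  · have := hle i
    exact_mod_cast this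
  · rw [block_map_ratCast]
    exact PsdWitness.posSemidef (hpsd k)

omit [Fintype E] [Fintype I] in
/-- The declared trace bounds, checked exactly at `y*`, hold for the real point.
[cite: JanssonChaykinKeil2008, Thm 3.2 (a-priori bound on the primal object)] -/
theorem traceBounds {P : Problem V E I K fun k => Fin (dims k)} {C : UpperCert V E I K dims}
    (h : traceCheck P C = true) : P.TraceBounds fun v => (C.y v : ℝ) := by
  simp only [traceCheck, decide_eq_true_eq] at h
  intro k q hq
  have := h k q hq
  rw [block_map_ratCast]
  have htr : ((P.blockQ k C.y).map (Rat.cast : ℚ → ℝ)).trace = ((P.blockQ k C.y).trace : ℝ) := by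
    simp [Matrix.trace, Rat.cast_sum]
  rw [htr]
  exact_mod_cast this

/-- **The objective at the certified point is below the claim.** [cite: JanssonChaykinKeil2008, Thm 4.1] -/
theorem obj_le {P : Problem V E I K fun k => Fin (dims k)} {C : UpperCert V E I K dims}
    (h : check P C = true) : P.obj (fun v => (C.y v : ℝ)) ≤ C.upperBound := by
  simp only [check, Bool.and_eq_true, decide_eq_true_eq] at h
  have := h.2
  show ∑ v, (P.c v : ℝ) * (C.y v : ℝ) + (P.c0 : ℝ) ≤ C.upperBound
  exact_mod_cast this

/-- **Soundness of the upper certificate** (`certsdp-primal/1`, both modes): the infimum of the objective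
over the feasible set is `≤ claimed.upper_bound` (Jansson–Chaykin–Keil Theorem 4.1: a feasible point bounds
`p*` from above; boundedness below is supplied e.g. by a lower certificate).
[cite: JanssonChaykinKeil2008, Thm 4.1, (4.1)–(4.3)] -/
theorem csInf_le {P : Problem V E I K fun k => Fin (dims k)} {C : UpperCert V E I K dims}
    (h : check P C = true) (hbdd : BddBelow (P.obj '' {y | P.Feasible y})) :
    sInf (P.obj '' {y | P.Feasible y}) ≤ C.upperBound :=
  (_root_.csInf_le hbdd ⟨_, feasible h, rfl⟩).trans (obj_le h)

end UpperCert

end Upper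

/-! ### §3 The two-sided bracket (lower `certsdp-conic/1` against upper `certsdp-primal/1`, both modes) -/

section Bracket

variable {V E I K : Type*} [Fintype V] [DecidableEq V] [Fintype E] [Fintype I] [Fintype K]
variable {dims : K → ℕ} {π : K → Type*} [∀ k, Fintype (π k)]

namespace UpperCert

/-- **Lower ≤ upper**: an accepted lower certificate and an accepted upper certificate (items in either
mode) for the same program, whose point satisfies the declared trace bounds, have
`claimed.lower_bound ≤ claimed.upper_bound`. [cite: JanssonChaykinKeil2008, Thm 3.2 and Thm 4.1] -/
theorem lowerBound_le_upperBound {P : Problem V E I K fun k => Fin (dims k)}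
    {L : LowerCert V E I K (fun k => Fin (dims k)) π} {U : UpperCert V E I K dims}
    (hL : LowerCert.check P L = true) (hU : check P U = true) (htr : traceCheck P U = true) :
    L.lowerBound ≤ U.upperBound := by
  have h := (LowerCert.sound hL (feasible hU) (traceBounds htr)).trans (obj_le hU)
  exact_mod_cast h

/-- **Lower ≤ upper, no penalised block**: as `lowerBound_le_upperBound`, without trace bounds, when every
eigenvalue floor of the lower certificate is `≥ 0`. [cite: JanssonChaykinKeil2008, Thm 3.2 and Thm 4.1] -/
theorem lowerBound_le_upperBound' {P : Problem V E I K fun k => Fin (dims k)}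
    {L : LowerCert V E I K (fun k => Fin (dims k)) π} {U : UpperCert V E I K dims}
    (hL : LowerCert.check P L = true) (h0 : ∀ k, 0 ≤ (L.wit k).dfloor) (hU : check P U = true) :
    L.lowerBound ≤ U.upperBound := by
  have h := (LowerCert.sound' hL h0 (feasible hU)).trans (obj_le hU)
  exact_mod_cast h

/-- **The enclosure**: with both certificates accepted (and the trace bounds at `y*`), the optimal value —
the infimum over the nonempty, bounded-below set of feasible points satisfying the declared trace bounds —
lies in `[claimed.lower_bound, claimed.upper_bound]`. [cite: JanssonChaykinKeil2008, Thm 3.2 and Thm 4.1] -/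
theorem csInf_mem_Icc {P : Problem V E I K fun k => Fin (dims k)}
    {L : LowerCert V E I K (fun k => Fin (dims k)) π} {U : UpperCert V E I K dims}
    (hL : LowerCert.check P L = true) (hU : check P U = true) (htr : traceCheck P U = true) :
    sInf (P.obj '' {y | P.Feasible y ∧ P.TraceBounds y}) ∈
      Set.Icc (L.lowerBound : ℝ) U.upperBound := by
  have hmem : P.obj (fun v => (U.y v : ℝ)) ∈ P.obj '' {y | P.Feasible y ∧ P.TraceBounds y} :=
    ⟨_, ⟨feasible hU, traceBounds htr⟩, rfl⟩
  have hbdd : BddBelow (P.obj '' {y | P.Feasible y ∧ P.TraceBounds y}) :=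
    ⟨L.lowerBound, by rintro _ ⟨y, ⟨hy, hy'⟩, rfl⟩; exact LowerCert.sound hL hy hy'⟩
  exact ⟨LowerCert.le_csInf hL ⟨_, hmem⟩, (_root_.csInf_le hbdd hmem).trans (obj_le hU)⟩

/-- **The enclosure, no penalised block**: the infimum over ALL feasible points lies in
`[claimed.lower_bound, claimed.upper_bound]`. [cite: JanssonChaykinKeil2008, Thm 3.2 and Thm 4.1] -/
theorem csInf_mem_Icc' {P : Problem V E I K fun k => Fin (dims k)}
    {L : LowerCert V E I K (fun k => Fin (dims k)) π} {U : UpperCert V E I K dims}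
    (hL : LowerCert.check P L = true) (h0 : ∀ k, 0 ≤ (L.wit k).dfloor) (hU : check P U = true) :
    sInf (P.obj '' {y | P.Feasible y}) ∈ Set.Icc (L.lowerBound : ℝ) U.upperBound := by
  have hbdd : BddBelow (P.obj '' {y | P.Feasible y}) :=
    ⟨L.lowerBound, by rintro _ ⟨y, hy, rfl⟩; exact LowerCert.sound' hL h0 hy⟩
  exact ⟨LowerCert.le_csInf' hL h0 ⟨_, _, feasible hU, rfl⟩, csInf_le hU hbdd⟩

end UpperCert

end Bracket

/-! ### §4 Composable acceptance: the linear part as a `Bool`, the PSD blocks from any proof source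

(Appended 2026-08-27, certnum-lean-2 gen 5.)  `UpperCert.check` evaluates every block's item through the
generic `Finset`/`ℚ` arithmetic of `CholWitness.accepts` / `exactAccepts`, which the kernel replays for small
blocks only (measured: `8 × 8` in seconds, `72 × 72` beyond the kernel's memory and time caps).  The
statements below split K-11 into its LINEAR part — `UpperCert.checkLinear : Bool` (`y*_u = 1`, bounds, equality
and inequality rows, `c·y* + c₀ ≤ claimed`; one cheap kernel evaluation) — and the per-block semidefiniteness
`M_k(y*) ⪰ 0` over `ℝ`, taken as a HYPOTHESIS that any lane may discharge (the items of this file via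
`PsdWitness.posSemidef`, a list-based kernel lane, or a structural argument).  Soundness is Jansson–Chaykin–Keil
Theorem 4.1 exactly as above; `check_eq_true_iff` records that the monolithic check is the conjunction. -/

section Parts

variable {V E I K : Type*} [Fintype V] [Fintype E] [Fintype I] [Fintype K] {dims : K → ℕ}

namespace UpperCert

/-- **The linear part of the acceptance check** (K-11 without the PSD items): `y*_u = 1`, every a-priori
bound, every equality row (exactly), every inequality row, and `c·y* + c₀ ≤ claimed`; a `Bool` of the exact
data. [folklore] -/
def checkLinear (P : Problem V E I K fun k => Fin (dims k)) (C : UpperCert V E I K dims) : Bool :=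
  decide (C.y P.unit = 1) && decide (∀ v, ∀ q ∈ P.rho v, |C.y v| ≤ q) &&
    decide (∀ e, ∑ v, P.rowE e v * C.y v = P.rhs e) &&
    decide (∀ i, ∑ v, P.rowI i v * C.y v ≤ P.upper i) &&
    decide (∑ v, P.c v * C.y v + P.c0 ≤ C.upperBound)

/-- **The acceptance check is the linear part AND one accepted item per block** (so a replay may prove
`check = true` from `checkLinear = true` and per-block `accepts = true` facts obtained separately).
[cite: JanssonChaykinKeil2008, Thm 4.1 (exact-data case: the enclosure is the point)] -/
theorem check_eq_true_iff (P : Problem V E I K fun k => Fin (dims k)) (C : UpperCert V E I K dims) :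
    check P C = true ↔
      checkLinear P C = true ∧ ∀ k, (C.wit k).accepts (P.blockQ k C.y) = true := by
  simp only [check, checkLinear, Bool.and_eq_true, decide_eq_true_eq]
  constructor
  · rintro ⟨⟨⟨⟨⟨hu, hbox⟩, heq⟩, hle⟩, hpsd⟩, hobj⟩
    exact ⟨⟨⟨⟨⟨hu, hbox⟩, heq⟩, hle⟩, hobj⟩, hpsd⟩
  · rintro ⟨⟨⟨⟨⟨hu, hbox⟩, heq⟩, hle⟩, hobj⟩, hpsd⟩
    exact ⟨⟨⟨⟨⟨hu, hbox⟩, heq⟩, hle⟩, hpsd⟩, hobj⟩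

omit [Fintype E] [Fintype I] [Fintype K] in
/-- The real block at a rational point is the cast of the exact block (as in §2). [folklore] -/
private theorem block_map_ratCast' (P : Problem V E I K fun k => Fin (dims k)) (k : K) (y : V → ℚ) :
    P.block k (fun v => (y v : ℝ)) = (P.blockQ k y).map (Rat.cast : ℚ → ℝ) := by
  ext a b
  simp [Problem.block, Problem.blockQ, Matrix.sum_apply, Rat.cast_sum, Rat.cast_mul, Rat.cast_add]

omit [Fintype K] in
/-- **Feasibility from the linear part and the blocks' semidefiniteness, however obtained**: if
`checkLinear` accepts and every `M_k(y*) ⪰ 0` over `ℝ`, the point `y*` is feasible (real semantics).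
[cite: JanssonChaykinKeil2008, Thm 4.1] -/
theorem feasible_of_checkLinear {P : Problem V E I K fun k => Fin (dims k)} {C : UpperCert V E I K dims}
    (h : checkLinear P C = true)
    (hpsd : ∀ k, ((P.blockQ k C.y).map (Rat.cast : ℚ → ℝ)).PosSemidef) :
    P.Feasible fun v => (C.y v : ℝ) := by
  simp only [checkLinear, Bool.and_eq_true, decide_eq_true_eq] at h
  obtain ⟨⟨⟨⟨hu, hbox⟩, heq⟩, hle⟩, _⟩ := h
  refine ⟨by exact_mod_cast hu, fun v q hq => ?_, fun e => ?_, fun i => ?_, fun k => ?_⟩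
  · have := hbox v q hq
    rw [← Rat.cast_abs]; exact_mod_cast this
  · have := heq e
    exact_mod_cast this
  · have := hle i
    exact_mod_cast this
  · rw [block_map_ratCast']
    exact hpsd k

omit [Fintype K] in
/-- The objective at the point is below the claim, from the linear part alone.
[cite: JanssonChaykinKeil2008, Thm 4.1] -/
theorem obj_le_of_checkLinear {P : Problem V E I K fun k => Fin (dims k)} {C : UpperCert V E I K dims}
    (h : checkLinear P C = true) : P.obj (fun v => (C.y v : ℝ)) ≤ C.upperBound := by
  simp only [checkLinear, Bool.and_eq_true, decide_eq_true_eq] at h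
  have := h.2
  show ∑ v, (P.c v : ℝ) * (C.y v : ℝ) + (P.c0 : ℝ) ≤ C.upperBound
  exact_mod_cast this

omit [Fintype K] in
/-- **Soundness of the upper certificate, composable form**: the linear part accepted and every block of
`M(y*)` positive semidefinite (from any source) give `inf ≤ claimed.upper_bound` over the (bounded-below)
feasible set — Jansson–Chaykin–Keil Theorem 4.1. [cite: JanssonChaykinKeil2008, Thm 4.1, (4.1)–(4.3)] -/
theorem csInf_le_of_checkLinear {P : Problem V E I K fun k => Fin (dims k)} {C : UpperCert V E I K dims}
    (h : checkLinear P C = true)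
    (hpsd : ∀ k, ((P.blockQ k C.y).map (Rat.cast : ℚ → ℝ)).PosSemidef)
    (hbdd : BddBelow (P.obj '' {y | P.Feasible y})) :
    sInf (P.obj '' {y | P.Feasible y}) ≤ C.upperBound :=
  (_root_.csInf_le hbdd ⟨_, feasible_of_checkLinear h hpsd, rfl⟩).trans (obj_le_of_checkLinear h)

/-- The items of THIS file are one admissible source of the semidefiniteness hypothesis: accepted items give
`M_k(y*) ⪰ 0` (so `feasible` factors through `feasible_of_checkLinear`).
[cite: Rump1999VerifiedLargeSystems, §4 eq. after (12) and Algorithm 4.1 step 7]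
[cite: BlekhermanParriloThomas2012, App. A.1.2] -/
theorem posSemidef_blocks_of_check {P : Problem V E I K fun k => Fin (dims k)} {C : UpperCert V E I K dims}
    (h : check P C = true) (k : K) : ((P.blockQ k C.y).map (Rat.cast : ℚ → ℝ)).PosSemidef :=
  PsdWitness.posSemidef (((check_eq_true_iff P C).1 h).2 k)

end UpperCert

end Parts

end ConicLayout

end Literature.Computation.Certificates
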